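import Literature.AlgebraicGeometry.HodgeTheory.MumfordTateRankUnitaryPairIntertwiner
import Literature.AlgebraicGeometry.HodgeTheory.MumfordTateRankUnitaryPairDescent
import HarnessLib

/-!
# Two unitary summands in graph position carry a non-zero HODGE MORPHISM `H₁ → H₂`
# (the unitary analogue of Moonen–Zarhin's Lemma (3.4), step 2: descent of the intertwiner to `ℚ`)

COR-CM (cell `pub-hodgecm2`, seat `b27` gen 52, count-neutral Mumford–Tate-rank ladder; theorems only, no definition, no named fact; UNCONDITIONAL —
nothing here uses or asserts HC_CM).  Sequel of `CorCM/MumfordTateRankUnitaryPairIntertwiner` (SETTING and GRAPH POSITION as there; in addition a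
polarization `ψ` of `H` and (Z): the `ψ`-skew central Hodge endomorphisms of `H` lie in `ℚ·ι₁φ₁π₁ + ℚ·ι₂φ₂π₂` — e.g. `End_Hdg(H) = End_Hdg(H₁) × End_Hdg(H₂)`).

* **`exists_hodgeMorphism_of_graph`** — in graph position there is a NON-ZERO `ℚ`-linear `f : H₁ → H₂` mapping `H₁^{p,q}` into `H₂^{p,q}`.
  PROOF.  The intertwiner `S : W₁ → W₂` of step 1 gives the complex solution `T = ι₂Sπ₁` of the RATIONAL system «`F = ι₂π₂Fι₁π₁` and `F` commutes
  with (a basis of) the derived algebra `𝔡 = [𝔥(H),𝔥(H)]`»; by descent the system has a rational solution `F ≠ 0`.  Every such `F` commutes with `Θ`: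
  write `Θ = c₁ι₁φ₁π₁ + c₂ι₂φ₂π₂ + Θ′` with `Θ′ ∈ 𝔡 ⊗ ℂ` (Deligne `𝔥 = 𝔷 ⊕ 𝔡` and (Z)); `S` intertwines `Θ` and `Θ′`, hence the central part, so
  `c₁μ₁ = c₂μ₂ =: s`, and the trace identity of step 1 gives `s·dim W₁ = dim W₁ − 2`, `s ∉ {0, ±1}`; the block `t = π₂Fι₁` intertwines
  `Θ′_i = Θ_i − c_iφ_{i,ℂ}`, whose spectra on `W₁ → W̄₂` (`{1−s, −1−s}` vs `{1+s, −1+s}`) and on `W̄₁ → W₂` are disjoint — so the cross blocks of `t`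
  vanish (`4s·Θ′₂y = 0`, `(s²−1)y = 0`) and the diagonal blocks commute with the central part.  Then `f = π₂Fι₁` respects the Hodge types.

## References
* [MoonenZarhin1999LowDim] B. Moonen, Yu. G. Zarhin, *Hodge classes on abelian varieties of low dimension*, Math. Ann. 315 (1999), §3 (3.1) and
  Lemma (3.4) [corpus: paper:arxiv-math_9901113 p. 6]. [cite: MoonenZarhin1999LowDim, §3 (3.1) and Lemma (3.4)]
* [Deligne1982HodgeCycles] P. Deligne, *Hodge cycles on abelian varieties*, LNM 900 (1982), I §3, Prop. 3.4, 3.6. [cite: Deligne1982HodgeCycles, I §3 (proof of Prop. 3.4)]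
* [Ribet1983] K. A. Ribet, Amer. J. Math. 105 (1983), Thm. 3. [cite: Ribet1983, Thm. 3]

Provenance: Literature home (namespace `Literature.AlgebraicGeometry.HodgeTheory.MumfordTateRank`) of the Summits-side `CorCM/MumfordTateRankUnitaryPairGraph` (cell `pub-hodgecm2`, COR-CM; all its imports are `Literature/`, Mathlib and the already re-homed `MumfordTateRankUnitaryPairIntertwiner`, `MumfordTateRankUnitaryPairDescent`), which `Literature/` may not import; theorems only, no named fact, no definition. Nothing here bears on `HC_CM`. Lane `lit-hodgefound` (Layer A3: CM types, their Kubota ranks and Galois combinatorics), seat p20.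
-/

noncomputable section

open scoped TensorProduct

namespace Literature.AlgebraicGeometry.HodgeTheory.MumfordTateRank

namespace UnitaryPair

open Literature.AlgebraicGeometry.Motives Literature.AlgebraicGeometry.Motives.HodgeStructure Module

universe u

/-! ## The Hodge morphism -/

section Main

variable {V₁ : Type u} [AddCommGroup V₁] [Module ℚ V₁] [Module.Finite ℚ V₁]
  {V₂ : Type u} [AddCommGroup V₂] [Module ℚ V₂] [Module.Finite ℚ V₂]
  {V : Type u} [AddCommGroup V] [Module ℚ V] [Module.Finite ℚ V] [HodgeTensorFacts.{u, u}] {n : ℤ}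
  {H₁ : HodgeStructure V₁ n} {H₂ : HodgeStructure V₂ n} {H : HodgeStructure V n}
  (ι₁ : Hom H₁ H) (π₁ : Hom H H₁) (ι₂ : Hom H₂ H) (π₂ : Hom H H₂)
  (hπι₁ : ∀ v, π₁.toLinearMap (ι₁.toLinearMap v) = v) (hπι₂ : ∀ v, π₂.toLinearMap (ι₂.toLinearMap v) = v)
  (hsum : ∀ v, ι₁.toLinearMap (π₁.toLinearMap v) + ι₂.toLinearMap (π₂.toLinearMap v) = v)
  (hn : n = 1) (heff₁ : H₁.IsEffective) (heff₂ : H₂.IsEffective) (ψ₁ : H₁.Polarization) (ψ₂ : H₂.Polarization) (ψ : H.Polarization)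
  {φ₁ : Module.End ℚ V₁} (hφ₁E : φ₁ ∈ H₁.endAlg) {d₁ : ℚ} (hd₁ : 0 < d₁) (hφ₁2 : φ₁ * φ₁ = -(d₁ • 1))
  (hE₁ : ∀ a ∈ H₁.endAlg, ∃ x y : ℚ, a = x • 1 + y • φ₁) {μ₁ : ℂ} (hμ₁ : μ₁ ^ 2 = -(d₁ : ℂ))
  (h1₁ : Module.finrank ℂ ↥(Module.End.eigenspace (φ₁.baseChange ℂ) μ₁ ⊓ H₁.piece 0 1) = 1)
  (h2₁ : 2 ≤ Module.finrank ℂ ↥(Module.End.eigenspace (φ₁.baseChange ℂ) μ₁ ⊓ H₁.piece 1 0))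
  {φ₂ : Module.End ℚ V₂} (hφ₂E : φ₂ ∈ H₂.endAlg) {d₂ : ℚ} (hd₂ : 0 < d₂) (hφ₂2 : φ₂ * φ₂ = -(d₂ • 1))
  (hE₂ : ∀ a ∈ H₂.endAlg, ∃ x y : ℚ, a = x • 1 + y • φ₂) {μ₂ : ℂ} (hμ₂ : μ₂ ^ 2 = -(d₂ : ℂ))
  (h1₂ : Module.finrank ℂ ↥(Module.End.eigenspace (φ₂.baseChange ℂ) μ₂ ⊓ H₂.piece 0 1) = 1)
  (h2₂ : 2 ≤ Module.finrank ℂ ↥(Module.End.eigenspace (φ₂.baseChange ℂ) μ₂ ⊓ H₂.piece 1 0))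
  (hrig₁ : ∀ 𝔞 : Submodule ℚ (Module.End ℚ V₁), 𝔞 ≤ H₁.hodgeLie →
      (∀ X ∈ 𝔞, ∀ Y ∈ 𝔞, X * Y - Y * X ∈ 𝔞) →
      (∃ Θ ∈ Submodule.span ℂ ((fun X : Module.End ℚ V₁ => X.baseChange ℂ) '' (𝔞 : Set (Module.End ℚ V₁))),
        ∀ p, ∀ x ∈ H₁.piece p (n - p), Θ x = ((2 * p - n : ℤ) : ℂ) • x) → H₁.hodgeLie ≤ 𝔞)
  (hK₁₂ : ∀ Z ∈ spanC H.hodgeLie, π₁.toLinearMap.baseChange ℂ ∘ₗ Z ∘ₗ ι₁.toLinearMap.baseChange ℂ = 0 →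
      ∃ k : ℂ, π₂.toLinearMap.baseChange ℂ ∘ₗ Z ∘ₗ ι₂.toLinearMap.baseChange ℂ = k • φ₂.baseChange ℂ)
  (hK₂₁ : ∀ Z ∈ spanC H.hodgeLie, π₂.toLinearMap.baseChange ℂ ∘ₗ Z ∘ₗ ι₂.toLinearMap.baseChange ℂ = 0 →
      ∃ k : ℂ, π₁.toLinearMap.baseChange ℂ ∘ₗ Z ∘ₗ ι₁.toLinearMap.baseChange ℂ = k • φ₁.baseChange ℂ)
  (hZ : ∀ z ∈ H.hodgeLie ⊓ Subalgebra.toSubmodule H.endAlg, ∃ x₁ x₂ : ℚ,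
      z = x₁ • (ι₁.toLinearMap ∘ₗ φ₁ ∘ₗ π₁.toLinearMap) + x₂ • (ι₂.toLinearMap ∘ₗ φ₂ ∘ₗ π₂.toLinearMap))

include hπι₁ hπι₂ hsum hn heff₁ heff₂ ψ₁ ψ₂ ψ hφ₁E hd₁ hφ₁2 hE₁ hμ₁ h1₁ h2₁ hφ₂E hd₂ hφ₂2 hE₂ hμ₂ h1₂ h2₂ hrig₁ hK₁₂ hK₂₁ hZ in
set_option maxHeartbeats 800000 in
/-- **A Goursat graph between two unitary Hodge Lie algebras of Ribet type `(m,1)` is induced by a Hodge morphism.**  In the SETTING of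
`CorCM/MumfordTateRankUnitaryPairIntertwiner` (weight one, `H ≅ H₁ ⊕ H₂`, imaginary quadratic `φ_i` of multiplicities `(m_i,1)`, `H₁` rigid), in GRAPH
POSITION (`hK₁₂`, `hK₂₁`) and with the `ψ`-skew centre of `End_Hdg(H)` inside `ℚι₁φ₁π₁ + ℚι₂φ₂π₂` (Z), there is a NON-ZERO `ℚ`-linear `f : H₁ → H₂`
respecting the Hodge decomposition.  (For `H_i = H¹(T_i)` of non-isogenous simple abelian threefolds this is absurd by Riemann's theorem — so the
Hodge Lie algebra of `T₁ × T₂` is never in graph position.)  Proof in the module docstring: intertwiner of step 1, descent (§1), and the vanishing of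
the cross blocks `W₁ → W̄₂`, `W̄₁ → W₂` by the disjoint spectra of `Θ′_i = Θ_i − c_iφ_{i,ℂ}`. [cite: MoonenZarhin1999LowDim, §3 (3.1) and Lemma (3.4)]
[cite: Deligne1982HodgeCycles, I §3 (proof of Prop. 3.4)] [cite: Ribet1983, Thm. 3] -/
theorem exists_hodgeMorphism_of_graph :
    ∃ f : V₁ →ₗ[ℚ] V₂, f ≠ 0 ∧ ∀ p, ∀ x ∈ H₁.piece p (n - p), f.baseChange ℂ x ∈ H₂.piece p (n - p) := by
  classical
  obtain ⟨Θ, hΘ⟩ := exists_hodgeTheta H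
  have hΘ𝔤 : Θ ∈ spanC H.hodgeLie := (hodgeLieC_eq_spanC H) ▸ H.mem_hodgeLieC_of_forall_piece hΘ
  obtain ⟨c₁, c₂, Θ', hΘ'𝔡, hΘdec⟩ := exists_theta_eq_center_add_derived ι₁ π₁ ι₂ π₂ ψ hZ hΘ𝔤
  obtain ⟨S, hS0, hSφ₁, hφ₂S, hSd, hSΘ, htr⟩ := exists_intertwiner_blocks ι₁ π₁ ι₂ π₂ hπι₁ hπι₂ hsum hn heff₁ heff₂ ψ₁ ψ₂ hφ₁E hd₁ hφ₁2 hE₁ hμ₁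
    h1₁ h2₁ hφ₂E hd₂ hφ₂2 hE₂ hμ₂ h1₂ h2₂ hrig₁ hΘ hK₁₂ hK₂₁
  subst hn
  -- notation
  set ι₁C := ι₁.toLinearMap.baseChange ℂ with hι₁C
  set π₁C := π₁.toLinearMap.baseChange ℂ with hπ₁C
  set ι₂C := ι₂.toLinearMap.baseChange ℂ with hι₂C
  set π₂C := π₂.toLinearMap.baseChange ℂ with hπ₂C
  set φ₁C := φ₁.baseChange ℂ with hφ₁C
  set φ₂C := φ₂.baseChange ℂ with hφ₂C
  set 𝔡 : Submodule ℚ (Module.End ℚ V) := Submodule.span ℚ {B | ∃ X ∈ H.hodgeLie, ∃ Y ∈ H.hodgeLie, X * Y - Y * X = B} with h𝔡def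
  have hπι₁' : π₁.toLinearMap ∘ₗ ι₁.toLinearMap = LinearMap.id := LinearMap.ext hπι₁
  have hπι₂' : π₂.toLinearMap ∘ₗ ι₂.toLinearMap = LinearMap.id := LinearMap.ext hπι₂
  have h11 : ∀ x, π₁C (ι₁C x) = x := fun x => proj_incl_baseChange hπι₁' x
  have h22 : ∀ x, π₂C (ι₂C x) = x := fun x => proj_incl_baseChange hπι₂' x
  have h21 : ∀ x, π₂C (ι₁C x) = 0 := fun x => proj_incl_baseChange_eq_zero (proj₂_comp_incl₁ ι₁ π₁ ι₂ π₂ hπι₁ hπι₂ hsum) x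
  have h12 : ∀ x, π₁C (ι₂C x) = 0 := fun x => proj_incl_baseChange_eq_zero (proj₁_comp_incl₂ ι₁ π₁ ι₂ π₂ hπι₁ hπι₂ hsum) x
  have h𝔡𝔥 : 𝔡 ≤ H.hodgeLie := Submodule.span_le.2 (by rintro _ ⟨X, hX, Y, hY, rfl⟩; exact H.commutator_mem_hodgeLie hX hY)
  have hblk : ∀ B ∈ spanC H.hodgeLie, ∀ x, B (ι₁C x) = ι₁C (π₁C (B (ι₁C x))) := fun B hB x =>
    apply_incl₁_of_mem_spanC ι₁ π₁ ι₂ π₂ hπι₁ hπι₂ hsum hB x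
  have hblk₂ : ∀ B ∈ spanC H.hodgeLie, ∀ y, B (ι₂C y) = ι₂C (π₂C (B (ι₂C y))) := fun B hB y =>
    apply_incl₂_of_mem_spanC ι₁ π₁ ι₂ π₂ hπι₁ hπι₂ hsum hB y
  -- the rational system: `F = ι₂π₂Fι₁π₁`, `[b_j, F] = 0` for a basis `b` of `𝔡`
  let b := Module.finBasis ℚ 𝔡
  let L₀ : Module.End ℚ V →ₗ[ℚ] Module.End ℚ V :=
    LinearMap.id - (LinearMap.llcomp ℚ V V V (ι₂.toLinearMap ∘ₗ π₂.toLinearMap)).comp (LinearMap.lcomp ℚ V (ι₁.toLinearMap ∘ₗ π₁.toLinearMap))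
  have hL₀ : ∀ F, L₀ F = F - (ι₂.toLinearMap ∘ₗ π₂.toLinearMap) ∘ₗ F ∘ₗ (ι₁.toLinearMap ∘ₗ π₁.toLinearMap) := fun F => rfl
  let LC₀ : Module.End ℂ (ℂ ⊗[ℚ] V) →ₗ[ℂ] Module.End ℂ (ℂ ⊗[ℚ] V) :=
    LinearMap.id - (LinearMap.llcomp ℂ _ _ _ (ι₂C ∘ₗ π₂C)).comp (LinearMap.lcomp ℂ _ (ι₁C ∘ₗ π₁C))
  have hLC₀ : ∀ T, LC₀ T = T - (ι₂C ∘ₗ π₂C) ∘ₗ T ∘ₗ (ι₁C ∘ₗ π₁C) := fun T => rfl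
  let Lj : Fin (Module.finrank ℚ 𝔡) → Module.End ℚ V →ₗ[ℚ] Module.End ℚ V := fun j =>
    LinearMap.mulLeft ℚ ((b j : 𝔡) : Module.End ℚ V) - LinearMap.mulRight ℚ ((b j : 𝔡) : Module.End ℚ V)
  have hLj : ∀ j F, Lj j F = ((b j : 𝔡) : Module.End ℚ V) * F - F * ((b j : 𝔡) : Module.End ℚ V) := fun j F => rfl
  let LCj : Fin (Module.finrank ℚ 𝔡) → Module.End ℂ (ℂ ⊗[ℚ] V) →ₗ[ℂ] Module.End ℂ (ℂ ⊗[ℚ] V) := fun j =>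
    LinearMap.mulLeft ℂ (((b j : 𝔡) : Module.End ℚ V).baseChange ℂ) - LinearMap.mulRight ℂ (((b j : 𝔡) : Module.End ℚ V).baseChange ℂ)
  have hLCj : ∀ j T, LCj j T = ((b j : 𝔡) : Module.End ℚ V).baseChange ℂ * T - T * ((b j : 𝔡) : Module.End ℚ V).baseChange ℂ := fun j T => rfl
  set 𝔐 : Submodule ℚ (Module.End ℚ V) := LinearMap.ker L₀ ⊓ Finset.univ.inf (fun j => LinearMap.ker (Lj j)) with h𝔐def
  -- the complex solution `T = ι₂ S π₁`
  set T : Module.End ℂ (ℂ ⊗[ℚ] V) := ι₂C ∘ₗ S ∘ₗ π₁C with hTdef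
  have hT𝔐 : T ∈ spanC 𝔐 := by
    rw [h𝔐def, spanC_inf, spanC_inf_finset]
    refine ⟨mem_spanC_ker_of_map_eq_zero L₀ LC₀ (fun X => by
        rw [hLC₀, hL₀, LinearMap.baseChange_sub, LinearMap.baseChange_comp, LinearMap.baseChange_comp, LinearMap.baseChange_comp,
          LinearMap.baseChange_comp]) ?_, Submodule.mem_finsetInf.2 fun j _ => mem_spanC_ker_of_map_eq_zero (Lj j) (LCj j) (fun X => by
        rw [hLCj, hLj, LinearMap.baseChange_sub, LinearMap.baseChange_mul, LinearMap.baseChange_mul]) ?_⟩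
    · rw [hLC₀, hTdef]
      refine sub_eq_zero.2 (LinearMap.ext fun x => ?_).symm
      simp only [LinearMap.comp_apply, h22, h11]
    · have hbj : (((b j : 𝔡) : Module.End ℚ V)).baseChange ℂ ∈ spanC 𝔡 := baseChange_mem_spanC (b j).2
      have hbj' : (((b j : 𝔡) : Module.End ℚ V)).baseChange ℂ ∈ spanC H.hodgeLie := spanC_mono h𝔡𝔥 hbj
      have hS := hSd _ hbj
      rw [hLCj, hTdef]
      refine sub_eq_zero.2 (LinearMap.ext fun x => ?_)
      have hbx : π₁C ((((b j : 𝔡) : Module.End ℚ V)).baseChange ℂ x) = π₁C ((((b j : 𝔡) : Module.End ℚ V)).baseChange ℂ (ι₁C (π₁C x))) := by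
        have h := congrArg (fun f => π₁C (f x)) (eq_sum_blocks_of_mem_spanC ι₁ π₁ ι₂ π₂ hπι₁ hπι₂ hsum hbj')
        simp only [LinearMap.add_apply, LinearMap.comp_apply] at h
        rw [← hι₁C, ← hπ₁C, ← hι₂C, ← hπ₂C, map_add, h11, h12, add_zero] at h
        exact h
      have h3 := congrArg (fun f => f (π₁C x)) hS
      simp only [LinearMap.comp_apply] at h3
      rw [Module.End.mul_apply, Module.End.mul_apply, LinearMap.comp_apply, LinearMap.comp_apply, LinearMap.comp_apply, LinearMap.comp_apply,
        hblk₂ _ hbj' (S (π₁C x)), h3, ← hbx]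
  -- `T ≠ 0`, so the rational system has a non-zero solution `F`
  have hT0 : T ≠ 0 := by
    intro h0
    apply hS0
    refine LinearMap.ext fun x => ?_
    have h := congrArg (fun f => π₂C (f (ι₁C x))) h0
    simp only [hTdef, LinearMap.comp_apply, LinearMap.zero_apply, map_zero, h11, h22] at h
    rw [h, LinearMap.zero_apply]
  obtain ⟨F, hF𝔐, hF0⟩ : ∃ F ∈ 𝔐, F ≠ 0 := by
    refine (Submodule.ne_bot_iff 𝔐).1 fun hbot => hT0 ?_
    rw [hbot] at hT𝔐
    have : spanC (⊥ : Submodule ℚ (Module.End ℚ V)) = ⊥ := by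
      apply (Submodule.eq_bot_iff _).2
      intro Z hZ'
      refine (Submodule.span_le.2 ?_) hZ' |> (Submodule.mem_bot ℂ).1
      rintro _ ⟨y, hy, rfl⟩
      rw [SetLike.mem_coe, show y = 0 from hy]
      change (0 : Module.End ℚ V).baseChange ℂ ∈ _
      rw [LinearMap.baseChange_zero]; exact Submodule.zero_mem _
    rw [this] at hT𝔐
    exact (Submodule.mem_bot ℂ).1 hT𝔐
  -- properties of `F`: block form and commutation with `𝔡`
  obtain ⟨hFL₀, hFj⟩ := Submodule.mem_inf.1 hF𝔐
  have hFblk : F = (ι₂.toLinearMap ∘ₗ π₂.toLinearMap) ∘ₗ F ∘ₗ (ι₁.toLinearMap ∘ₗ π₁.toLinearMap) := by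
    have h := LinearMap.mem_ker.1 hFL₀
    rw [hL₀, sub_eq_zero] at h
    exact h
  have hF𝔡 : ∀ B ∈ 𝔡, F * B = B * F := by
    intro B hB
    have hrepr := b.sum_repr ⟨B, hB⟩
    have hB' : B = ∑ j, b.repr ⟨B, hB⟩ j • ((b j : 𝔡) : Module.End ℚ V) := by
      have h := congrArg Subtype.val hrepr
      rw [Submodule.coe_sum] at h
      simp only [Submodule.coe_smul] at h
      exact h.symm
    have hj : ∀ j, F * ((b j : 𝔡) : Module.End ℚ V) = ((b j : 𝔡) : Module.End ℚ V) * F := fun j => by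
      have h := LinearMap.mem_ker.1 (Submodule.mem_finsetInf.1 hFj j (Finset.mem_univ j))
      rw [hLj, sub_eq_zero] at h
      exact h.symm
    rw [hB', Finset.mul_sum, Finset.sum_mul]
    refine Finset.sum_congr rfl fun j _ => ?_
    rw [mul_smul_comm, smul_mul_assoc, hj]
  have hFC𝔡 : ∀ B ∈ spanC 𝔡, F.baseChange ℂ * B = B * F.baseChange ℂ := fun B hB =>
    commute_of_mem_spanC (fun X hX => by rw [← LinearMap.baseChange_mul, hF𝔡 X hX, LinearMap.baseChange_mul]) hB
  -- the block `t = π₂ F ι₁` and the decomposition `Θ = c₁E₁ + c₂E₂ + Θ'`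
  set t : ℂ ⊗[ℚ] V₁ →ₗ[ℂ] ℂ ⊗[ℚ] V₂ := π₂C ∘ₗ F.baseChange ℂ ∘ₗ ι₁C with htdef
  have hFC : F.baseChange ℂ = ι₂C ∘ₗ t ∘ₗ π₁C := by
    conv_lhs => rw [hFblk]
    rw [htdef, LinearMap.baseChange_comp, LinearMap.baseChange_comp, LinearMap.baseChange_comp, LinearMap.baseChange_comp]
    rfl
  -- the blocks `Θ_i` of `Θ` are Hodge operators of `H_i`
  set Θ₁ : Module.End ℂ (ℂ ⊗[ℚ] V₁) := π₁C ∘ₗ Θ ∘ₗ ι₁C with hΘ₁def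
  set Θ₂ : Module.End ℂ (ℂ ⊗[ℚ] V₂) := π₂C ∘ₗ Θ ∘ₗ ι₂C with hΘ₂def
  have hι₁F : ∀ p, ∀ x ∈ H₁.piece p (1 - p), ι₁C x ∈ H.piece p (1 - p) := fun p x hx => ι₁.map_piece_le p _ ⟨x, hx, rfl⟩
  have hι₂F : ∀ p, ∀ x ∈ H₂.piece p (1 - p), ι₂C x ∈ H.piece p (1 - p) := fun p x hx => ι₂.map_piece_le p _ ⟨x, hx, rfl⟩
  have hΘ₁ : ∀ p, ∀ x ∈ H₁.piece p (1 - p), Θ₁ x = ((2 * p - 1 : ℤ) : ℂ) • x := fun p x hx => by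
    rw [hΘ₁def, LinearMap.comp_apply, LinearMap.comp_apply, hΘ p _ (hι₁F p x hx), map_smul, h11]
  have hΘ₂ : ∀ p, ∀ x ∈ H₂.piece p (1 - p), Θ₂ x = ((2 * p - 1 : ℤ) : ℂ) • x := fun p x hx => by
    rw [hΘ₂def, LinearMap.comp_apply, LinearMap.comp_apply, hΘ p _ (hι₂F p x hx), map_smul, h22]
  obtain ⟨hP₁, -, -, -, hΘΘ₁⟩ := UnitaryTheta.theta_facts H₁ rfl heff₁ hΘ₁
  obtain ⟨hP₂, hQ₂, -, -, hΘΘ₂⟩ := UnitaryTheta.theta_facts H₂ rfl heff₂ hΘ₂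
  have hΘ₁φ : Θ₁ * φ₁C = φ₁C * Θ₁ := commute_baseChange_of_mem_hodgeLieC H₁ (H₁.mem_hodgeLieC_of_forall_piece hΘ₁) ⟨φ₁, hφ₁E⟩
  have hΘ₂φ : Θ₂ * φ₂C = φ₂C * Θ₂ := commute_baseChange_of_mem_hodgeLieC H₂ (H₂.mem_hodgeLieC_of_forall_piece hΘ₂) ⟨φ₂, hφ₂E⟩
  -- the blocks of `Θ'`
  have hΘ'eq : Θ' = Θ - c₁ • (ι₁C ∘ₗ φ₁C ∘ₗ π₁C) - c₂ • (ι₂C ∘ₗ φ₂C ∘ₗ π₂C) := by rw [hΘdec]; abel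
  have hA₁ : π₁C ∘ₗ Θ' ∘ₗ ι₁C = Θ₁ - c₁ • φ₁C := by
    rw [hΘ'eq]
    refine LinearMap.ext fun x => ?_
    simp only [LinearMap.comp_apply, LinearMap.sub_apply, LinearMap.smul_apply, map_sub, map_smul, h11, h12, smul_zero, sub_zero, hΘ₁def]
  have hA₂ : π₂C ∘ₗ Θ' ∘ₗ ι₂C = Θ₂ - c₂ • φ₂C := by
    rw [hΘ'eq]
    refine LinearMap.ext fun x => ?_
    simp only [LinearMap.comp_apply, LinearMap.sub_apply, LinearMap.smul_apply, map_sub, map_smul, h22, h21, smul_zero, sub_zero, hΘ₂def]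
  have hΘ'𝔥 : Θ' ∈ spanC H.hodgeLie := spanC_mono h𝔡𝔥 hΘ'𝔡
  -- `c₁μ₁ = c₂μ₂ =: s`, via the intertwiner `S`
  have hs : c₂ * μ₂ = c₁ * μ₁ := by
    have h1 := hSd Θ' hΘ'𝔡
    rw [hA₁, hA₂, LinearMap.sub_comp, LinearMap.comp_sub, LinearMap.smul_comp, LinearMap.comp_smul, hSΘ, hφ₂S, hSφ₁, smul_smul, smul_smul,
      sub_right_inj] at h1
    obtain ⟨x, hx⟩ : ∃ x, S x ≠ 0 := by
      by_contra h
      exact hS0 (LinearMap.ext fun x => not_not.1 (not_exists.1 h x))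
    have h2 := congrArg (fun f => f x) h1
    simp only [LinearMap.smul_apply] at h2
    have h3 : (c₂ * μ₂ - c₁ * μ₁) • S x = 0 := by rw [sub_smul, h2, sub_self]
    rcases smul_eq_zero.1 h3 with h | h
    · exact sub_eq_zero.1 h
    · exact absurd h hx
  set s : ℂ := c₁ * μ₁ with hsdef
  -- the value of `s`: `s · dim W₁ = dim W₁ − 2`, `dim W₁ ≥ 3`, so `s ≠ 0`, `s² ≠ 1`
  have hsg := htr Θ' hΘ'𝔡 s (fun w hw => by
    rw [hA₁, LinearMap.sub_apply, LinearMap.smul_apply, Module.End.mem_eigenspace_iff.1 hw, smul_smul])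
  have hg : 3 ≤ Module.finrank ℂ ↥(Module.End.eigenspace φ₁C μ₁) := by
    have hdisj : Module.End.eigenspace φ₁C μ₁ ⊓ H₁.piece 1 0 ⊓ (Module.End.eigenspace φ₁C μ₁ ⊓ H₁.piece 0 1) = ⊥ := by
      refine (Submodule.eq_bot_iff _).2 fun x hx => ?_
      have h1 : Θ₁ x = x := by simpa using hΘ₁ 1 x (Submodule.mem_inf.1 (Submodule.mem_inf.1 hx).1).2
      have h0 : Θ₁ x = -x := by simpa using hΘ₁ 0 x (Submodule.mem_inf.1 (Submodule.mem_inf.1 hx).2).2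
      have h2 : (2 : ℂ) • x = 0 := by rw [two_smul]; nth_rewrite 1 [← h1]; rw [h0, neg_add_cancel]
      exact (smul_eq_zero.1 h2).resolve_left two_ne_zero
    have hle := Submodule.finrank_mono (le_trans (sup_le inf_le_left inf_le_left) le_rfl :
      Module.End.eigenspace φ₁C μ₁ ⊓ H₁.piece 1 0 ⊔ Module.End.eigenspace φ₁C μ₁ ⊓ H₁.piece 0 1 ≤ Module.End.eigenspace φ₁C μ₁)
    have hdim := Submodule.finrank_sup_add_finrank_inf_eq (Module.End.eigenspace φ₁C μ₁ ⊓ H₁.piece 1 0)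
      (Module.End.eigenspace φ₁C μ₁ ⊓ H₁.piece 0 1)
    rw [hdisj, finrank_bot, add_zero, h1₁] at hdim
    omega
  have hs0 : s ≠ 0 := by
    intro h
    rw [h, zero_mul, eq_comm, sub_eq_zero] at hsg
    norm_cast at hsg
    omega
  have hs1 : s ^ 2 ≠ 1 := by
    intro h
    have h' : (s - 1) * (s + 1) = 0 := by linear_combination h
    rcases mul_eq_zero.1 h' with h' | h'
    · rw [sub_eq_zero.1 h', one_mul] at hsg
      have : (0 : ℂ) = -2 := by linear_combination hsg
      norm_num at this
    · rw [eq_neg_of_add_eq_zero_left h'] at hsg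
      have h3 : ((Module.finrank ℂ ↥(Module.End.eigenspace φ₁C μ₁) : ℕ) : ℂ) = 1 := by linear_combination -(1/2 : ℂ) * hsg
      norm_cast at h3
      omega
  -- the block `t` intertwines `Θ'_i = Θ_i − c_iφ_{i,ℂ}`
  have htA : ∀ x, t ((Θ₁ - c₁ • φ₁C) x) = (Θ₂ - c₂ • φ₂C) (t x) := by
    intro x
    have e2 := congrArg (fun f => π₂C (f (ι₁C x))) (hFC𝔡 Θ' hΘ'𝔡)
    simp only [Module.End.mul_apply] at e2
    have e3 : F.baseChange ℂ (ι₁C x) = ι₂C (t x) := by rw [hFC]; simp only [LinearMap.comp_apply, h11]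
    rw [hblk Θ' hΘ'𝔥 x, e3, hblk₂ Θ' hΘ'𝔥, h22] at e2
    have lhs : t ((Θ₁ - c₁ • φ₁C) x) = π₂C (F.baseChange ℂ (ι₁C (π₁C (Θ' (ι₁C x))))) := by rw [← hA₁]; rfl
    have rhs : (Θ₂ - c₂ • φ₂C) (t x) = π₂C (Θ' (ι₂C (t x))) := by rw [← hA₂]; rfl
    rw [lhs, rhs, e2]
  -- projectors `e_i` onto `W_i` along `W̄_i`
  obtain ⟨hμ0₁, -⟩ := UnitaryTheta.conj_eq_neg_of_sq hd₁ hμ₁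
  obtain ⟨hμ0₂, -⟩ := UnitaryTheta.conj_eq_neg_of_sq hd₂ hμ₂
  have hφφ₁ : ∀ x, φ₁C (φ₁C x) = (μ₁ * μ₁) • x := fun x => by rw [hφ₁C, UnitaryTheta.baseChange_baseChange_apply hφ₁2, ← sq, hμ₁, neg_smul]
  have hφφ₂ : ∀ x, φ₂C (φ₂C x) = (μ₂ * μ₂) • x := fun x => by rw [hφ₂C, UnitaryTheta.baseChange_baseChange_apply hφ₂2, ← sq, hμ₂, neg_smul]
  obtain ⟨he₁W, he₁W', -⟩ := projector_facts φ₁C hμ0₁ hφφ₁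
  obtain ⟨he₂W, he₂W', he₂comm⟩ := projector_facts φ₂C hμ0₂ hφφ₂
  set e₁ : Module.End ℂ (ℂ ⊗[ℚ] V₁) := (2 * μ₁)⁻¹ • (μ₁ • 1 + φ₁C) with he₁def
  set e₂ : Module.End ℂ (ℂ ⊗[ℚ] V₂) := (2 * μ₂)⁻¹ • (μ₂ • 1 + φ₂C) with he₂def
  -- `A₂ = Θ₂ − c₂φ₂` acts as `Θ₂ ∓ s` on `W₂`, `W̄₂`; `A₁` as `Θ₁ ∓ s` on `W₁`, `W̄₁`
  have hA₂W : ∀ y, φ₂C y = μ₂ • y → (Θ₂ - c₂ • φ₂C) y = Θ₂ y - s • y := fun y hy => by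
    rw [LinearMap.sub_apply, LinearMap.smul_apply, hy, smul_smul, hs]
  have hA₂W' : ∀ y, φ₂C y = (-μ₂) • y → (Θ₂ - c₂ • φ₂C) y = Θ₂ y + s • y := fun y hy => by
    rw [LinearMap.sub_apply, LinearMap.smul_apply, hy, smul_smul, mul_neg, hs, hsdef, neg_smul, sub_neg_eq_add]
  have hA₁W : ∀ x, φ₁C x = μ₁ • x → (Θ₁ - c₁ • φ₁C) x = Θ₁ x - s • x := fun x hx => by
    rw [LinearMap.sub_apply, LinearMap.smul_apply, hx, smul_smul]
  have hA₁W' : ∀ x, φ₁C x = (-μ₁) • x → (Θ₁ - c₁ • φ₁C) x = Θ₁ x + s • x := fun x hx => by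
    rw [LinearMap.sub_apply, LinearMap.smul_apply, hx, smul_smul, mul_neg, hsdef, neg_smul, sub_neg_eq_add]
  have hA₂comm : (Θ₂ - c₂ • φ₂C) * φ₂C = φ₂C * (Θ₂ - c₂ • φ₂C) := by
    rw [sub_mul, mul_sub, hΘ₂φ, smul_mul_assoc, mul_smul_comm]
  have hΘ₁W : ∀ x, φ₁C x = μ₁ • x → φ₁C (Θ₁ x) = μ₁ • Θ₁ x := fun x hx => by
    rw [← Module.End.mul_apply, ← hΘ₁φ, Module.End.mul_apply, hx, map_smul]
  have hΘ₁W' : ∀ x, φ₁C x = (-μ₁) • x → φ₁C (Θ₁ x) = (-μ₁) • Θ₁ x := fun x hx => by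
    rw [← Module.End.mul_apply, ← hΘ₁φ, Module.End.mul_apply, hx, map_smul]
  have hΘ₂W : ∀ y, φ₂C y = μ₂ • y → φ₂C (Θ₂ y) = μ₂ • Θ₂ y := fun y hy => by
    rw [← Module.End.mul_apply, ← hΘ₂φ, Module.End.mul_apply, hy, map_smul]
  have hΘ₂W' : ∀ y, φ₂C y = (-μ₂) • y → φ₂C (Θ₂ y) = (-μ₂) • Θ₂ y := fun y hy => by
    rw [← Module.End.mul_apply, ← hΘ₂φ, Module.End.mul_apply, hy, map_smul]
  -- the cross blocks of `t` vanish
  have hX : ∀ u, φ₁C u = μ₁ • u → t u - e₂ (t u) = 0 := by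
    intro u hu
    -- `Φ v := t v − e₂ (t v)` satisfies `(A₂ + s)(Φ v) = Φ(Θ₁ v)` on `W₁`
    have hΦ : ∀ v, φ₁C v = μ₁ • v → (Θ₂ - c₂ • φ₂C) (t v - e₂ (t v)) + s • (t v - e₂ (t v)) = t (Θ₁ v) - e₂ (t (Θ₁ v)) := by
      intro v hv
      rw [map_sub, ← he₂comm _ hA₂comm, ← htA, hA₁W v hv]
      simp only [map_sub, map_smul]
      module
    have hW' : φ₂C (t u - e₂ (t u)) = (-μ₂) • (t u - e₂ (t u)) := he₂W' (t u)
    refine eq_zero_of_shift_sq (Θ₂ - c₂ • φ₂C) hs0 hs1 ?_ ?_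
    · rw [hΦ u hu, hΦ (Θ₁ u) (hΘ₁W u hu), hΘΘ₁]
    · rw [hA₂W' _ hW', add_sub_cancel_right, hA₂W' _ (hΘ₂W' _ hW'), hΘΘ₂, add_sub_cancel_right]
  have hX' : ∀ u, φ₁C u = (-μ₁) • u → e₂ (t u) = 0 := by
    intro u hu
    have hΦ : ∀ v, φ₁C v = (-μ₁) • v → (Θ₂ - c₂ • φ₂C) (e₂ (t v)) - s • e₂ (t v) = e₂ (t (Θ₁ v)) := by
      intro v hv
      rw [← he₂comm _ hA₂comm, ← htA, hA₁W' v hv]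
      simp only [map_add, map_smul]
      module
    have hW : φ₂C (e₂ (t u)) = μ₂ • e₂ (t u) := he₂W (t u)
    refine eq_zero_of_shift_sq (Θ₂ - c₂ • φ₂C) (neg_ne_zero.2 hs0) (by rw [neg_sq]; exact hs1) ?_ ?_
    · rw [neg_smul, ← sub_eq_add_neg, neg_smul, ← sub_eq_add_neg, hΦ u hu, hΦ (Θ₁ u) (hΘ₁W' u hu), hΘΘ₁]
    · rw [neg_smul, sub_neg_eq_add, neg_smul, sub_neg_eq_add, hA₂W _ hW, sub_add_cancel, hA₂W _ (hΘ₂W _ hW), hΘΘ₂, sub_add_cancel]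
  -- hence `c₂ φ₂ t = c₁ t φ₁`
  have hcomm : ∀ x, c₂ • φ₂C (t x) = c₁ • t (φ₁C x) := by
    intro x
    have hu : φ₁C (e₁ x) = μ₁ • e₁ x := he₁W x
    have hu' : φ₁C (x - e₁ x) = (-μ₁) • (x - e₁ x) := he₁W' x
    have hx : x = e₁ x + (x - e₁ x) := by abel
    have h1 : t (e₁ x) = e₂ (t (e₁ x)) := (sub_eq_zero.1 (hX _ hu))
    have h2 : φ₂C (t (e₁ x)) = μ₂ • t (e₁ x) := by rw [h1, he₂W, ← h1]
    have h3 : φ₂C (t (x - e₁ x)) = (-μ₂) • t (x - e₁ x) := by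
      have h := he₂W' (t (x - e₁ x)); rwa [hX' _ hu', sub_zero] at h
    conv_lhs => rw [hx, map_add, map_add, h2, h3]
    conv_rhs => rw [hx, map_add, hu, hu', map_add, map_smul, map_smul]
    rw [smul_add, smul_add, smul_smul, smul_smul, smul_smul, smul_smul, mul_neg, mul_neg, hs]
  -- `F_ℂ` commutes with `Θ`
  have hFΘ : ∀ v, F.baseChange ℂ (Θ v) = Θ (F.baseChange ℂ v) := by
    intro v
    have h' := congrArg (fun f => f v) (hFC𝔡 Θ' hΘ'𝔡)
    simp only [Module.End.mul_apply] at h'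
    conv_lhs => rw [hΘdec]
    conv_rhs => rw [hFC, hΘdec]
    rw [LinearMap.add_apply, LinearMap.add_apply, map_add, map_add, h', hFC]
    simp only [LinearMap.comp_apply, LinearMap.add_apply, LinearMap.smul_apply, map_smul, h11, h12, h22, map_zero,
      smul_zero, zero_add, add_zero]
    rw [← LinearMap.map_smul ι₂C c₁, ← LinearMap.map_smul ι₂C c₂, hcomm]
  -- the Hodge morphism `f = π₂ F ι₁`
  refine ⟨π₂.toLinearMap ∘ₗ F ∘ₗ ι₁.toLinearMap, fun hf => hF0 ?_, fun p x hx => ?_⟩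
  · refine LinearMap.ext fun v => ?_
    have h := congrArg (fun g => ι₂.toLinearMap (g (π₁.toLinearMap v))) hf
    simp only [LinearMap.comp_apply, LinearMap.zero_apply, map_zero] at h
    rw [hFblk]
    simpa only [LinearMap.comp_apply, LinearMap.zero_apply] using h
  · have htx : (π₂.toLinearMap ∘ₗ F ∘ₗ ι₁.toLinearMap).baseChange ℂ x = t x := by
      rw [LinearMap.baseChange_comp, LinearMap.baseChange_comp]
    rw [htx]
    have hΘt : Θ₂ (t x) = ((2 * p - 1 : ℤ) : ℂ) • t x := by
      have h := hFΘ (ι₁C x)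
      rw [hΘ p _ (hι₁F p x hx), map_smul, hFC] at h
      simp only [LinearMap.comp_apply, h11] at h
      rw [hΘ₂def, LinearMap.comp_apply, LinearMap.comp_apply, ← h, map_smul, h22]
    by_cases hp1 : p = 1
    · subst hp1
      have h1 : Θ₂ (t x) = t x := by rw [hΘt]; norm_num
      have h := hP₂ (t x)
      rw [h1, ← two_smul ℂ, smul_smul, inv_mul_cancel₀ two_ne_zero, one_smul] at h
      have e : (1 : ℤ) - 1 = 0 := by norm_num
      rw [e]; exact h
    by_cases hp0 : p = 0
    · subst hp0
      have h0 : Θ₂ (t x) = -t x := by rw [hΘt]; norm_num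
      have h := hQ₂ (t x)
      rw [h0, sub_neg_eq_add, ← two_smul ℂ, smul_smul, inv_mul_cancel₀ two_ne_zero, one_smul] at h
      have e : (1 : ℤ) - 0 = 1 := by norm_num
      rw [e]; exact h
    · have hbot : H₁.piece p (1 - p) = ⊥ := by
        by_contra hne
        have h := heff₁ p (1 - p) hne
        omega
      rw [hbot, Submodule.mem_bot] at hx
      rw [hx, map_zero]
      exact Submodule.zero_mem _

end Main

end UnitaryPair

end Literature.AlgebraicGeometry.HodgeTheory.MumfordTateRank

end
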